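import Summits.AtomisticToContinuum.FouriersLaw.Theorems.HiddenChargeMazurOddChargeAlgebraDefs

/-!
# Odd conservation laws of the pinned anharmonic chain — toolkit, part A

Elementary calculus in the chain algebra `𝓡 = ℝ[q_x, p_x : x ∈ ℤ]` shared by all files of the
refutation of `HiddenChargeMazur.OddChargeExists`: partial derivatives (`pderiv`) commute,
the kernel of `∂_v` consists of the polynomials not involving `X v` (characteristic zero),
algebra endomorphisms / derivations are controlled by their values on generators, the
free-streaming derivation `A⁺ = Σ p_x ∂_{q_x}` (commutators `[∂_{p_x}, A⁺] = ∂_{q_x}`,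
`[∂_{q_x}, A⁺] = 0`, finite-sum form on polynomials of bounded support) and the site
translations `shiftBy k` / `shift`.  Everything is folklore polynomial algebra. [folklore]
-/

noncomputable section

open MvPolynomial Finsupp
open scoped BigOperators

namespace Summit.AtomisticToContinuum.FouriersLaw.Theorems.OddChargeAlgebra

/-! ### Generators: algebra maps and derivations -/

/-- An algebra endomorphism `φ` of `𝓡` intertwines two derivations (`φ ∘ D = D' ∘ φ`) as soon
as it does so on the variables. [folklore] -/
theorem algHom_derivation_comm {φ : R →ₐ[ℝ] R} {D D' : Derivation ℝ R R}
    (h : ∀ v : Var, φ (D (X v)) = D' (φ (X v))) (f : R) : φ (D f) = D' (φ f) := by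
  induction f using MvPolynomial.induction_on with
  | C a => simp [MvPolynomial.algebraMap_eq]
  | add p q hp hq => simp [hp, hq]
  | mul_X p v hp =>
    rw [Derivation.leibniz, map_mul, Derivation.leibniz, smul_eq_mul, smul_eq_mul, smul_eq_mul,
      smul_eq_mul, map_add, map_mul, map_mul, h, hp]

/-- A derivation of `𝓡` maps `supported ℝ S` into `supported ℝ T ⊇ supported ℝ S` as soon as
it maps the variables of `S` there. [folklore] -/
theorem derivation_mem_supported {S T : Set Var} {D : Derivation ℝ R R} (hST : S ⊆ T)
    (hD : ∀ v ∈ S, D (X v) ∈ supported ℝ T) {f : R} (hf : f ∈ supported ℝ S) :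
    D f ∈ supported ℝ T := by
  change f ∈ Algebra.adjoin ℝ _ at hf
  induction hf using Algebra.adjoin_induction with
  | mem g hg =>
    obtain ⟨v, hv, rfl⟩ := hg
    exact hD v hv
  | algebraMap r =>
    rw [Derivation.map_algebraMap]
    exact zero_mem _
  | add g g' _ _ hg hg' =>
    rw [map_add]
    exact add_mem hg hg'
  | mul g g' hg₀ hg₀' hg hg' =>
    rw [Derivation.leibniz, smul_eq_mul, smul_eq_mul]
    exact add_mem (mul_mem (supported_mono hST hg₀) hg') (mul_mem (supported_mono hST hg₀') hg)

/-- An algebra endomorphism of `𝓡` maps `supported ℝ S` into `supported ℝ T` as soon as it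
maps the variables of `S` there. [folklore] -/
theorem algHom_mem_supported {S T : Set Var} {φ : R →ₐ[ℝ] R}
    (hφ : ∀ v ∈ S, φ (X v) ∈ supported ℝ T) {f : R} (hf : f ∈ supported ℝ S) :
    φ f ∈ supported ℝ T := by
  change f ∈ Algebra.adjoin ℝ _ at hf
  induction hf using Algebra.adjoin_induction with
  | mem g hg =>
    obtain ⟨v, hv, rfl⟩ := hg
    exact hφ v hv
  | algebraMap r =>
    rw [AlgHom.commutes]
    exact Subalgebra.algebraMap_mem _ r
  | add g g' _ _ hg hg' =>
    rw [map_add]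
    exact add_mem hg hg'
  | mul g g' _ _ hg hg' =>
    rw [map_mul]
    exact mul_mem hg hg'

/-! ### Partial derivatives -/

/-- Partial derivatives commute. [folklore] -/
theorem pderiv_comm (v w : Var) (f : R) : pderiv v (pderiv w f) = pderiv w (pderiv v f) := by
  rcases eq_or_ne v w with rfl | hvw
  · rfl
  ext m
  simp only [coeff_pderiv, Finsupp.coe_add, Pi.add_apply, Finsupp.single_apply, hvw, hvw.symm,
    if_false, add_zero]
  rw [add_right_comm m (Finsupp.single w 1) (Finsupp.single v 1)]
  ring

/-- `∂_v f = 0` iff no monomial of `f` involves the variable `v` (characteristic zero).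
[folklore] -/
theorem pderiv_eq_zero_iff (v : Var) (f : R) : pderiv v f = 0 ↔ ∀ m ∈ f.support, m v = 0 := by
  constructor
  · intro h m hm
    by_contra hv
    have hle : Finsupp.single v 1 ≤ m :=
      Finsupp.single_le_iff.mpr (Nat.one_le_iff_ne_zero.mpr hv)
    have h1 := congrArg (coeff (m - Finsupp.single v 1)) h
    rw [coeff_pderiv, coeff_zero, tsub_add_cancel_of_le hle] at h1
    rcases mul_eq_zero.mp h1 with h2 | h2
    · exact (MvPolynomial.mem_support_iff.mp hm) h2
    · exact Nat.cast_add_one_ne_zero _ h2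
  · intro h
    ext m
    rw [coeff_pderiv, coeff_zero]
    by_cases hm : m + Finsupp.single v 1 ∈ f.support
    · have := h _ hm
      simp at this
    · rw [MvPolynomial.notMem_support_iff.mp hm, zero_mul]

/-- A polynomial with `∂_v f = 0` does not involve the variable `v`. [folklore] -/
theorem not_mem_vars_of_pderiv_eq_zero {v : Var} {f : R} (h : pderiv v f = 0) : v ∉ f.vars := by
  intro hv
  obtain ⟨d, hd, hvd⟩ := (mem_vars_iff_mem_support v).mp hv
  exact (Finsupp.mem_support_iff.mp hvd) ((pderiv_eq_zero_iff v f).mp h d hd)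

/-- The substitution `X v ↦ 0` fixes every polynomial not involving `v`. [folklore] -/
theorem killVar_eq_self_of_not_mem_vars {v : Var} {f : R} (hv : v ∉ f.vars) :
    killVar v f = f := by
  change (killVar v).toRingHom f = RingHom.id R f
  refine hom_congr_vars ?_ (fun i hi _ => ?_) rfl
  · ext r
    simp [MvPolynomial.algebraMap_eq]
  · have hi' : i ≠ v := fun e => hv (e ▸ hi)
    simp [killVar, hi']

/-- The substitution `X v ↦ 0` fixes every `f` with `∂_v f = 0`. [folklore] -/
theorem killVar_eq_self_of_pderiv {v : Var} {f : R} (h : pderiv v f = 0) : killVar v f = f :=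
  killVar_eq_self_of_not_mem_vars (not_mem_vars_of_pderiv_eq_zero h)

/-- A polynomial free of `v` (`∂_v f = 0`) that vanishes at `X v = 0` is zero. [folklore] -/
theorem eq_zero_of_pderiv_of_killVar {v : Var} {f : R} (h1 : pderiv v f = 0)
    (h2 : killVar v f = 0) : f = 0 := by
  rw [← killVar_eq_self_of_pderiv h1]
  exact h2

/-- Derivations kill numerals. [folklore] -/
@[simp] theorem pderiv_ofNat (v : Var) (n : ℕ) [n.AtLeastTwo] :
    pderiv v (ofNat(n) : R) = 0 :=
  Derivation.map_natCast _ n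

/-- `∂_{q_i} q_j = 0` for `i ≠ j`. [folklore] -/
theorem pderiv_inl_X_inl_of_ne {i j : ℤ} (h : i ≠ j) :
    pderiv (Sum.inl i) (X (Sum.inl j) : R) = 0 :=
  pderiv_X_of_ne (by simpa using (Ne.symm h))

/-! ### Free streaming `A⁺` -/

/-- `A⁺ q_x = p_x`. [folklore] -/
@[simp] theorem Aplus_X_inl (x : ℤ) : Aplus (X (Sum.inl x) : R) = X (Sum.inr x) := by
  simp [Aplus, mkDerivation_X]

/-- `A⁺ p_x = 0`. [folklore] -/
@[simp] theorem Aplus_X_inr (x : ℤ) : Aplus (X (Sum.inr x) : R) = 0 := by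
  simp [Aplus, mkDerivation_X]

/-- `A⁺` kills constants. [folklore] -/
@[simp] theorem Aplus_C (c : ℝ) : Aplus (C c : R) = 0 := derivation_C _ _

/-- The commutator `[∂_{p_x}, A⁺] = ∂_{q_x}`. [folklore] -/
theorem pderiv_inr_Aplus : ∀ (x : ℤ) (f : R),
    pderiv (Sum.inr x) (Aplus f) = Aplus (pderiv (Sum.inr x) f) + pderiv (Sum.inl x) f := by
  intro x f
  have key : ⁅(pderiv (Sum.inr x) : Derivation ℝ R R), Aplus⁆ = pderiv (Sum.inl x) := by
    refine MvPolynomial.derivation_ext fun v => ?_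
    rw [Derivation.commutator_apply]
    rcases v with y | y
    · by_cases h : y = x
      · subst h
        simp
      · simp [h]
    · by_cases h : y = x
      · subst h
        simp
      · simp [h]
  have := congrArg (fun D : Derivation ℝ R R => D f) key
  simp only [Derivation.commutator_apply] at this
  rw [← this]
  ring

/-- The commutator `[∂_{q_x}, A⁺] = 0`. [folklore] -/
theorem pderiv_inl_Aplus (x : ℤ) (f : R) :
    pderiv (Sum.inl x) (Aplus f) = Aplus (pderiv (Sum.inl x) f) := by
  have key : ⁅(pderiv (Sum.inl x) : Derivation ℝ R R), Aplus⁆ = 0 := by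
    refine MvPolynomial.derivation_ext fun v => ?_
    rw [Derivation.commutator_apply, Derivation.zero_apply]
    rcases v with y | y
    · by_cases h : y = x
      · subst h
        simp
      · simp [h]
    · simp
  have := congrArg (fun D : Derivation ℝ R R => D f) key
  simpa [Derivation.commutator_apply, sub_eq_zero] using this

/-- On polynomials supported on the sites of a finset `s`, `A⁺ = Σ_{x ∈ s} p_x ∂_{q_x}`.
[folklore] -/
theorem Aplus_eq_finset_sum {f : R} {s : Finset ℤ}
    (hf : f ∈ supported ℝ (Var.site ⁻¹' (↑s : Set ℤ))) :
    Aplus f = ∑ x ∈ s, X (Sum.inr x) * pderiv (Sum.inl x) f := by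
  change f ∈ Algebra.adjoin ℝ _ at hf
  induction hf using Algebra.adjoin_induction with
  | mem g hg =>
    obtain ⟨v, hv, rfl⟩ := hg
    rcases v with y | y
    · have hy : y ∈ s := by simpa [Var.site] using hv
      simp [Pi.single_apply, hy]
    · simp
  | algebraMap r => simp [MvPolynomial.algebraMap_eq]
  | add g g' _ _ hg hg' => simp only [map_add, hg, hg', mul_add, Finset.sum_add_distrib]
  | mul g g' _ _ hg hg' =>
    simp only [Derivation.leibniz, smul_eq_mul, hg, hg', Finset.mul_sum,
      ← Finset.sum_add_distrib]
    refine Finset.sum_congr rfl fun x _ => ?_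
    ring

/-- On polynomials supported on the sites `a, …, b`, `A⁺ = Σ_{x=a}^{b} p_x ∂_{q_x}`. [folklore] -/
theorem Aplus_eq_sum_Icc {f : R} {a b : ℤ}
    (hf : f ∈ supported ℝ (Var.site ⁻¹' Set.Icc a b)) :
    Aplus f = ∑ x ∈ Finset.Icc a b, X (Sum.inr x) * pderiv (Sum.inl x) f :=
  Aplus_eq_finset_sum (by simpa using hf)

/-- `A⁺ f` has a momentum in every monomial: it vanishes at `p = 0`. [folklore] -/
theorem killP_Aplus (f : R) : killP (Aplus f) = 0 := by
  induction f using MvPolynomial.induction_on with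
  | C a => simp
  | add p q hp hq => simp [hp, hq]
  | mul_X p v hp =>
    rw [Derivation.leibniz, map_add, smul_eq_mul, smul_eq_mul, map_mul, map_mul, hp, mul_zero,
      add_zero]
    rcases v with y | y <;> simp [killP]

/-- `A⁺ f` vanishes at `p = 0` (version with the support hypothesis of the skeleton).
[folklore] -/
theorem killP_Aplus_of_mem {f : R} (_hf : f ∈ supported ℝ (Set.range (Sum.inl : ℤ → Var))) :
    killP (Aplus f) = 0 :=
  killP_Aplus f

/-- `A⁺` does not enlarge the set of sites. [folklore] -/
theorem Aplus_mem_supported_site {T : Set ℤ} {f : R} (hf : f ∈ supported ℝ (Var.site ⁻¹' T)) :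
    Aplus f ∈ supported ℝ (Var.site ⁻¹' T) := by
  refine derivation_mem_supported subset_rfl (fun v hv => ?_) hf
  rcases v with y | y
  · rw [Aplus_X_inl]
    exact X_mem_supported.mpr hv
  · rw [Aplus_X_inr]
    exact zero_mem _

/-! ### Site translations -/

/-- `transl k` on a position variable. [folklore] -/
@[simp] theorem transl_inl (k x : ℤ) : transl k (Sum.inl x) = Sum.inl (x + k) := rfl

/-- `transl k` on a momentum variable. [folklore] -/
@[simp] theorem transl_inr (k x : ℤ) : transl k (Sum.inr x) = Sum.inr (x + k) := rfl

/-- `transl k` shifts the site by `k`. [folklore] -/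
@[simp] theorem site_transl (k : ℤ) (v : Var) : Var.site (transl k v) = Var.site v + k := by
  cases v <;> rfl

/-- `transl k` is injective. [folklore] -/
theorem transl_injective (k : ℤ) : Function.Injective (transl k) :=
  Sum.map_injective.mpr ⟨add_left_injective k, add_left_injective k⟩

/-- `shiftBy k (X v) = X (transl k v)`. [folklore] -/
@[simp] theorem shiftBy_X (k : ℤ) (v : Var) : shiftBy k (X v) = X (transl k v) := rename_X _ _

/-- `shiftBy k` fixes constants. [folklore] -/
@[simp] theorem shiftBy_C (k : ℤ) (c : ℝ) : shiftBy k (C c) = C c := rename_C _ _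

/-- `S q_x = q_{x+1}`. [folklore] -/
@[simp] theorem shift_X_inl (x : ℤ) : shift (X (Sum.inl x) : R) = X (Sum.inl (x + 1)) :=
  rename_X _ _

/-- `S p_x = p_{x+1}`. [folklore] -/
@[simp] theorem shift_X_inr (x : ℤ) : shift (X (Sum.inr x) : R) = X (Sum.inr (x + 1)) :=
  rename_X _ _

/-- `S` fixes constants. [folklore] -/
@[simp] theorem shift_C (c : ℝ) : shift (C c : R) = C c := rename_C _ _

/-- `shiftBy 0 = id`. [folklore] -/
@[simp] theorem shiftBy_zero_apply (f : R) : shiftBy 0 f = f := by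
  have h : transl 0 = id := by
    funext v
    cases v <;> simp
  rw [shiftBy, h, rename_id]
  rfl

/-- `shiftBy (j + k) = shiftBy j ∘ shiftBy k`. [folklore] -/
theorem shiftBy_add_apply (j k : ℤ) (f : R) : shiftBy (j + k) f = shiftBy j (shiftBy k f) := by
  have h : transl (j + k) = transl j ∘ transl k := by
    funext v
    cases v <;> simp <;> abel
  rw [shiftBy, shiftBy, shiftBy, rename_rename, h]

/-- `S ∘ S⁻¹ = id`. [folklore] -/
@[simp] theorem shift_shiftBy_neg_one (f : R) : shift (shiftBy (-1) f) = f := by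
  rw [shift, ← shiftBy_add_apply]
  norm_num

/-- `S⁻¹ ∘ S = id`. [folklore] -/
@[simp] theorem shiftBy_neg_one_shift (f : R) : shiftBy (-1) (shift f) = f := by
  rw [shift, ← shiftBy_add_apply]
  norm_num

/-- The shift is injective. [folklore] -/
theorem shift_injective : Function.Injective (shift : R → R) :=
  Function.LeftInverse.injective shiftBy_neg_one_shift

/-- `∂_{transl k v} ∘ shiftBy k = shiftBy k ∘ ∂_v`. [folklore] -/
theorem pderiv_shiftBy (k : ℤ) (v : Var) (f : R) :
    pderiv (transl k v) (shiftBy k f) = shiftBy k (pderiv v f) :=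
  pderiv_rename (transl_injective k) v f

/-- `∂_{q_{x+1}} ∘ S = S ∘ ∂_{q_x}`. [folklore] -/
theorem pderiv_inl_shift (x : ℤ) (f : R) :
    pderiv (Sum.inl (x + 1)) (shift f) = shift (pderiv (Sum.inl x) f) :=
  pderiv_shiftBy 1 (Sum.inl x) f

/-- `∂_{p_{x+1}} ∘ S = S ∘ ∂_{p_x}`. [folklore] -/
theorem pderiv_inr_shift (x : ℤ) (f : R) :
    pderiv (Sum.inr (x + 1)) (shift f) = shift (pderiv (Sum.inr x) f) :=
  pderiv_shiftBy 1 (Sum.inr x) f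

/-- `∂_{q_x} ∘ S = S ∘ ∂_{q_{x-1}}`. [folklore] -/
theorem pderiv_inl_shift' (x : ℤ) (f : R) :
    pderiv (Sum.inl x) (shift f) = shift (pderiv (Sum.inl (x - 1)) f) := by
  have := pderiv_inl_shift (x - 1) f
  rwa [sub_add_cancel] at this

/-- `∂_{p_x} ∘ S = S ∘ ∂_{p_{x-1}}`. [folklore] -/
theorem pderiv_inr_shift' (x : ℤ) (f : R) :
    pderiv (Sum.inr x) (shift f) = shift (pderiv (Sum.inr (x - 1)) f) := by
  have := pderiv_inr_shift (x - 1) f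
  rwa [sub_add_cancel] at this

/-- `S γ_j = γ_{j+1}`. [folklore] -/
@[simp] theorem shift_gam (j : ℤ) : shift (gam j) = gam (j + 1) := by
  simp [gam]

/-- `S` is multiplicative on the cubic `cub`. [folklore] -/
theorem shift_cub (a b : R) : shift (cub a b) = cub (shift a) (shift b) := by
  simp [cub, map_ofNat]

/-- `S (∏_{j ∈ [a,b)} γ_j²) = ∏_{j ∈ [a+1,b+1)} γ_j²`. [folklore] -/
theorem shift_prodsq_Ico (a b : ℤ) :
    shift (prodsq (Finset.Ico a b)) = prodsq (Finset.Ico (a + 1) (b + 1)) := by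
  simp only [prodsq, map_prod, map_pow, shift_gam]
  exact Finset.prod_Ico_add' (fun j => gam j ^ 2) a b 1

/-- The variables of `S f` are translates of the variables of `f`. [folklore] -/
theorem mem_vars_shift {f : R} {v : Var} (hv : v ∈ (shift f).vars) :
    ∃ w ∈ f.vars, transl 1 w = v := by
  classical
  obtain ⟨w, hw, rfl⟩ := Finset.mem_image.mp (vars_rename (transl 1) f hv)
  exact ⟨w, hw, rfl⟩

/-- A shift-invariant polynomial is constant. [folklore] -/
theorem eq_C_of_shift_eq {f : R} (h : shift f = f) : f = C (f.coeff 0) := by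
  classical
  rw [← vars_eq_empty_iff_eq_C]
  have hsub : f.vars.image Var.site ⊆ (f.vars.image Var.site).image (· + 1) := by
    intro x hx
    obtain ⟨v, hv, rfl⟩ := Finset.mem_image.mp hx
    rw [← h] at hv
    obtain ⟨w, hw, rfl⟩ := mem_vars_shift hv
    exact Finset.mem_image.mpr
      ⟨Var.site w, Finset.mem_image.mpr ⟨w, hw, rfl⟩, (site_transl 1 w).symm⟩
  by_contra hne
  have hS : (f.vars.image Var.site).Nonempty :=
    Finset.image_nonempty.mpr (Finset.nonempty_iff_ne_empty.mpr hne)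
  obtain ⟨y, hy, hy'⟩ := Finset.mem_image.mp (hsub (Finset.min'_mem _ hS))
  have := Finset.min'_le _ y hy
  omega

/-- `S ∘ A⁺ = A⁺ ∘ S`. [folklore] -/
theorem shift_Aplus (f : R) : shift (Aplus f) = Aplus (shift f) :=
  algHom_derivation_comm (fun v => by rcases v with y | y <;> simp) f

end Summit.AtomisticToContinuum.FouriersLaw.Theorems.OddChargeAlgebra

end
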